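import Literature.NumberTheory.Automorphic.VanDijkTraceParabolicIndGLKMU
import Literature.NumberTheory.Automorphic.VanDijkTraceParabolicIndGL
import Literature.NumberTheory.Automorphic.GLnIntegralLeviUnipotent
import Literature.NumberTheory.Automorphic.ClosedCompactDecomposition
import HarnessLib

/-!
# van Dijk's trace formula for `Ind_{P_c}^{GL_N(F)}(χ)` — the predicate ★ `VanDijkTraceParabolicIndGL` HOLDS
# (van Dijk 1972, Thm. p. 237; Bernstein–Zelevinsky 1977 §2.3; Rogawski 1990 Lemma 4.13.1 (b) «standard»)

Topic `NumberTheory/Automorphic`; namespace `Literature.NumberTheory.Automorphic`.  THEOREMS ONLY (no definition, no instance, no notation, no named fact, no `sorry`).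
Cell `pub/hodgecm-mathlib`, line «CMCharIdentityTest» — brick VD-5 (ii-c), the LAST of the `stub_vanDijkGL` road (census
`B-provers/B-p18/g31/CENSUS-VD-vanDijkGL-road.B-p18g31.md`): from the KMU form ★ `GLn.exists_smoothTrace_parabolicIndGL_eq_integral_KMU` to the normal form of the predicate ★
`VanDijkTraceParabolicIndGL` (p840961): (α) `∫_K` moved inside `∫_M ∫_U` (Fubini on `K × (M × U)`, continuous compactly supported integrand), (β) `k ↦ k⁻¹` on the compact
`K = GL_N(𝒪)` (★ `isInvInvariant_of_compactSpace`) and `∫_U ∫_K = ∫_{K × U}`, (γ) the constant: the two calibration identities at `1_K` and `1_{P ∩ K}` with ★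
`levi_mul_unipotent_mem_glInt_iff` give `C = ν(K) ∕ ν_M(M_c ∩ K)` for the unit-mass measures on `K` and `U_c ∩ K`.
* §1 helpers: indicators of compact open subgroups are continuous compactly supported test functions; compact support of `(k, m, u) ↦ f(k⁻¹ (m u) k)`.
* §2 **`GLn.vanDijkTraceParabolicIndGL_holds`** — for a monotone labelling `c`, a character `χ` of the block Levi with OPEN KERNEL, and Haar measures `ν`, `ν_M`:
  `VanDijkTraceParabolicIndGL F c χ ν ν_M` (Borel structure `borel _` on `GL_N(F)`, as in the predicate's consumers).
HONEST LABEL: HC_CM is proved only modulo the printed citations (2 remaining named inputs hLiu418, h413) until rung 0 closes; with this file `stub_vanDijkGL` of the F0P3b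
line is payable by instantiation (`χ = maxParabolicLeviChar ν₀ ψ_w` has open kernel by ★ `Liu2021.SplitPlace.isOpen_ker_maxParabolicLeviChar`).

## References
* [vanDijk1972] G. van Dijk, *Computation of certain induced characters of 𝔭-adic groups*, Math. Ann. 199 (1972), 229–240, Thm. p. 237.
* [BernsteinZelevinsky1977] I. N. Bernstein, A. V. Zelevinsky, *Induced representations of reductive 𝔭-adic groups I*, §2.3.
* [Rogawski1990] J. D. Rogawski, *Automorphic Representations of Unitary Groups in Three Variables* (1990), §4.13 Lemma 4.13.1 (b) p. 64.
-/

set_option autoImplicit false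

noncomputable section

open MeasureTheory MeasureTheory.Measure Topology TopologicalSpace
open scoped MatrixGroups NNReal ENNReal

namespace Literature.NumberTheory.Automorphic

open Literature.NumberTheory.GaloisRepresentations.IsNonarchimedeanLocalField

/-! ## §1 Helpers -/

section Helpers

variable {X : Type*} [Group X] [TopologicalSpace X] [IsTopologicalGroup X]

/-- The indicator of a compact open subgroup is a continuous compactly supported test function (a level of itself, ★ `IsLevel.indicator`). [cite: BernsteinZelevinsky1977, §1.8] -/
theorem continuous_indicator_subgroup {S : Subgroup X} (hSo : IsOpen (S : Set X)) (hSc : IsCompact (S : Set X)) :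
    Continuous ((S : Set X).indicator fun _ => (1 : ℂ)) :=
  (IsLevel.indicator hSo hSc).isLocallyConstant.continuous

/-- … and has compact support. [cite: BernsteinZelevinsky1977, §1.8] -/
theorem hasCompactSupport_indicator_subgroup {S : Subgroup X} (hSo : IsOpen (S : Set X)) (hSc : IsCompact (S : Set X)) :
    HasCompactSupport ((S : Set X).indicator fun _ => (1 : ℂ)) :=
  HasCompactSupport.intro' hSc (Subgroup.isClosed_of_isOpen _ hSo) fun _ hx => Set.indicator_of_notMem hx _

omit [IsTopologicalGroup X] in
/-- `∫ 1_S = μ.real S` for an open `S`. [cite: BernsteinZelevinsky1977, §1.8] -/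
theorem integral_indicator_subgroup [MeasurableSpace X] [BorelSpace X] (μ : Measure X) {S : Subgroup X} (hSo : IsOpen (S : Set X)) :
    ∫ x, (S : Set X).indicator (fun _ => (1 : ℂ)) x ∂μ = μ.real (S : Set X) := by
  rw [integral_indicator_const (1 : ℂ) hSo.measurableSet, Complex.real_smul, mul_one]

end Helpers

variable {F : Type} [Field F] [ValuativeRel F] [TopologicalSpace F] [IsNonarchimedeanLocalField F]
  {N : ℕ} {α : Type*} [LinearOrder α] [Fintype α] {c : Fin N → α}

/-- `GL_n(F)` is second countable. [folklore] -/
private theorem secondCountableTopology_GL₄ : SecondCountableTopology (GL (Fin N) F) := by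
  haveI : SecondCountableTopology F := secondCountableTopology_localField F
  haveI : SecondCountableTopology (Matrix (Fin N) (Fin N) F) :=
    inferInstanceAs (SecondCountableTopology (Fin N → Fin N → F))
  haveI : SecondCountableTopology (Matrix (Fin N) (Fin N) F)ᵐᵒᵖ :=
    MulOpposite.opHomeomorph.symm.secondCountableTopology
  exact Units.isEmbedding_embedProduct.secondCountableTopology

/-- `GL_n(F)` is locally compact. [folklore] -/
private theorem locallyCompactSpace_GL₄ : LocallyCompactSpace (GL (Fin N) F) := by
  haveI : T2Space F := (isLocalField F).toT2Space
  haveI : LocallyCompactSpace F := (isLocalField F).toLocallyCompactSpace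
  haveI : LocallyCompactSpace (Matrix (Fin N) (Fin N) F) :=
    inferInstanceAs (LocallyCompactSpace (Fin N → Fin N → F))
  infer_instance

/-- **Compact support on `M_c × U_c` from a compact constraint on `m u`**: if `g(m, u) ≠ 0` forces `m u ∈ T` for a compact `T ⊆ GL_N(F)`, then `g` has compact support —
the support lies in the image under `M_c × U_c ≃ₜ P_c` of the preimage of `T` under the closed embedding `P_c ↪ GL_N(F)`. [cite: BernsteinZelevinsky1977, §2.3] -/
theorem hasCompactSupport_of_levi_mul_unipotent_mem (e : ↥(standardLeviGL F c) × ↥(unipotentRadicalGL F c) ≃ₜ ↥(standardParabolicGL F c))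
    (he : ∀ q, ((e q : ↥(standardParabolicGL F c)) : GL (Fin N) F) = (q.1 : GL (Fin N) F) * (q.2 : GL (Fin N) F))
    {E : Type*} [Zero E] {g : ↥(standardLeviGL F c) × ↥(unipotentRadicalGL F c) → E} {T : Set (GL (Fin N) F)} (hT : IsCompact T)
    (hg : ∀ q, g q ≠ 0 → (q.1 : GL (Fin N) F) * (q.2 : GL (Fin N) F) ∈ T) : HasCompactSupport g := by
  haveI : T2Space F := (isLocalField F).toT2Space
  have hTP : IsCompact (((↑) : ↥(standardParabolicGL F c) → GL (Fin N) F) ⁻¹' T) :=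
    (isClosed_standardParabolicGL F c).isClosedEmbedding_subtypeVal.isCompact_preimage hT
  refine HasCompactSupport.intro' (hTP.image e.symm.continuous) ((hTP.image e.symm.continuous).isClosed) fun q hq => ?_
  by_contra hne
  apply hq
  refine ⟨e q, ?_, e.symm_apply_apply q⟩
  rw [Set.mem_preimage, he]
  exact hg q hne

/-- `K · S · K` is compact for compact `S` (`K = GL_N(𝒪)`); it contains every `k⁻¹ x k′`, `x ∈ S`. [cite: BernsteinZelevinsky1977, §2.3] -/
theorem isCompact_glInt_mul_mul_glInt {S : Set (GL (Fin N) F)} (hS : IsCompact S) :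
    IsCompact ((fun t : GL (Fin N) F × GL (Fin N) F × GL (Fin N) F => t.1 * t.2.1 * t.2.2) ''
      ((glInt N F : Set (GL (Fin N) F)) ×ˢ S ×ˢ (glInt N F : Set (GL (Fin N) F)))) :=
  ((isCompact_glInt (n := N) (F := F)).prod (hS.prod (isCompact_glInt (n := N) (F := F)))).image
    ((continuous_fst.mul (continuous_fst.comp continuous_snd)).mul (continuous_snd.comp continuous_snd))

/-- `δ_P^{1∕2}` is continuous. [cite: BernsteinZelevinsky1977, 1.7] -/
theorem continuous_rootDeltaChar_unitsCoe' {G : Type*} [Group G] [TopologicalSpace G] [IsTopologicalGroup G] (P : Subgroup G)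
    [LocallyCompactSpace ↥P] [MeasurableSpace ↥P] [BorelSpace ↥P] : Continuous fun p : ↥P => ((rootDeltaChar P p : ℂˣ) : ℂ) := by
  simp only [rootDeltaChar_apply]
  exact Complex.continuous_ofReal.comp (NNReal.continuous_coe.comp (NNReal.continuous_sqrt.comp
    Literature.MeasureTheory.Group.continuous_modularCharacter))

/-- A homomorphism to `ℂˣ` with open kernel is locally constant. [cite: BernsteinZelevinsky1977, §1.8] -/
theorem isLocallyConstant_unitsCoe_of_isOpen_ker' {H : Type*} [Group H] [TopologicalSpace H] [ContinuousMul H] (χ : H →* ℂˣ)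
    (hχ : IsOpen (χ.ker : Set H)) : IsLocallyConstant (fun h => ((χ h : ℂˣ) : ℂ)) := by
  refine (IsLocallyConstant.iff_exists_open _).2 fun h => ⟨(fun k => h * k) '' (χ.ker : Set H), (isOpenMap_mul_left h) _ hχ, ⟨1, χ.ker.one_mem, mul_one h⟩, ?_⟩
  rintro _ ⟨k, hk, rfl⟩
  rw [map_mul, (MonoidHom.mem_ker).1 hk, mul_one]

/-! ## §2 The theorem -/

set_option maxHeartbeats 3200000 in
/-- **van Dijk's formula holds for `GL_N(F)`**: for a monotone labelling `c`, a character `χ` of the block Levi with open kernel, and Haar measures `ν` on `GL_N(F)`, `ν_M`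
on `M_c` (Borel structure `borel _`), ★ `VanDijkTraceParabolicIndGL F c χ ν ν_M`:
`tr (Ind χ)(f dν) = (ν(K) ∕ ν_M(M_c ∩ K)) ∫_{M_c} χ(m) δ^{1∕2}(m) ∫_{K × U_c} f(k (m u) k⁻¹) d(κ¹ ⊗ μ¹_U) dν_M`.
[cite: vanDijk1972, Thm. p. 237] [cite: BernsteinZelevinsky1977, §2.3] [cite: Rogawski1990, §4.13 Lemma 4.13.1 (b) p. 64] -/
theorem GLn.vanDijkTraceParabolicIndGL_holds (hc : Monotone c)
    (χ : (Π a, GL {i : Fin N // c i = a} F) →* ℂˣ) (hχ : IsOpen (χ.ker : Set (Π a, GL {i : Fin N // c i = a} F))) :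
    letI : MeasurableSpace (GL (Fin N) F) := borel _
    ∀ (ν : Measure (GL (Fin N) F)) [ν.IsHaarMeasure] (νM : Measure ↥(standardLeviGL F c)) [νM.IsHaarMeasure],
      VanDijkTraceParabolicIndGL F c χ ν νM := by
  letI : MeasurableSpace (GL (Fin N) F) := borel _
  haveI : BorelSpace (GL (Fin N) F) := ⟨rfl⟩
  intro ν _ νM _ f hflc hfcs
  haveI : T2Space F := (isLocalField F).toT2Space
  haveI : SecondCountableTopology (GL (Fin N) F) := secondCountableTopology_GL₄
  haveI : LocallyCompactSpace (GL (Fin N) F) := locallyCompactSpace_GL₄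
  have hKo : IsOpen (glInt N F : Set (GL (Fin N) F)) := isOpen_glInt (n := N) (F := F)
  have hKc : IsCompact (glInt N F : Set (GL (Fin N) F)) := isCompact_glInt (n := N) (F := F)
  haveI : CompactSpace ↥(glInt N F) := isCompact_iff_compactSpace.1 hKc
  have hPcl : IsClosed (standardParabolicGL F c : Set (GL (Fin N) F)) := isClosed_standardParabolicGL F c
  have hMcl : IsClosed (standardLeviGL F c : Set (GL (Fin N) F)) := isClosed_standardLeviGL (R := F) c
  have hUcl : IsClosed (unipotentRadicalGL F c : Set (GL (Fin N) F)) := isClosed_unipotentRadicalGL (R := F) c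
  haveI : SecondCountableTopology ↥(standardLeviGL F c) := inferInstanceAs (SecondCountableTopology ↥((standardLeviGL F c : Set (GL (Fin N) F))))
  haveI : SecondCountableTopology ↥(unipotentRadicalGL F c) :=
    inferInstanceAs (SecondCountableTopology ↥((unipotentRadicalGL F c : Set (GL (Fin N) F))))
  haveI : SecondCountableTopology ↥(glInt N F) := inferInstanceAs (SecondCountableTopology ↥((glInt N F : Set (GL (Fin N) F))))
  haveI : SecondCountableTopology ↥(standardParabolicGL F c) :=
    inferInstanceAs (SecondCountableTopology ↥((standardParabolicGL F c : Set (GL (Fin N) F))))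
  haveI : SigmaCompactSpace (GL (Fin N) F) := sigmaCompactSpace_of_locallyCompact_secondCountable
  haveI : SigmaCompactSpace ↥(standardLeviGL F c) := hMcl.isClosedEmbedding_subtypeVal.sigmaCompactSpace
  haveI : SigmaCompactSpace ↥(unipotentRadicalGL F c) := hUcl.isClosedEmbedding_subtypeVal.sigmaCompactSpace
  haveI : SigmaCompactSpace ↥(standardParabolicGL F c) := hPcl.isClosedEmbedding_subtypeVal.sigmaCompactSpace
  haveI : BorelSpace (↥(standardLeviGL F c) × ↥(unipotentRadicalGL F c)) := Prod.borelSpace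
  haveI : BorelSpace (↥(glInt N F) × ↥(unipotentRadicalGL F c)) := Prod.borelSpace
  haveI : BorelSpace (↥(glInt N F) × (↥(standardLeviGL F c) × ↥(unipotentRadicalGL F c))) := Prod.borelSpace
  -- the unit-mass measures of the predicate
  set KK : PositiveCompacts ↥(glInt N F) := ⟨⟨Set.univ, isCompact_iff_isCompact_univ.1 (isCompact_glInt (n := N) (F := F))⟩, by
      simp only [interior_univ, Set.univ_nonempty]⟩ with hKK
  set UU : PositiveCompacts ↥(unipotentRadicalGL F c) := ⟨⟨((↑) : ↥(unipotentRadicalGL F c) → GL (Fin N) F) ⁻¹' (glInt N F : Set (GL (Fin N) F)),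
      haveI := (isLocalField F).toT2Space
      (isClosed_unipotentRadicalGL (R := F) c).isClosedEmbedding_subtypeVal.isCompact_preimage (isCompact_glInt (n := N) (F := F))⟩,
      ⟨1, ((isOpen_glInt (n := N) (F := F)).preimage continuous_subtype_val).interior_eq.symm ▸ (glInt N F).one_mem⟩⟩ with hUU
  set μK : Measure ↥(glInt N F) := haarMeasure KK with hμK
  set μU : Measure ↥(unipotentRadicalGL F c) := haarMeasure UU with hμU
  haveI : SigmaFinite νM := inferInstance
  haveI : SigmaFinite μU := inferInstance
  haveI : μK.IsInvInvariant := isInvInvariant_of_compactSpace μK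
  -- ★ the KMU form
  obtain ⟨μP, hμP, C, hC, hHK, hPint, hKMU⟩ :=
    GLn.exists_smoothTrace_parabolicIndGL_eq_integral_KMU (F := F) hc χ hχ ν νM μU μK
  haveI := hμP
  haveI : SigmaFinite μP := inferInstance
  rw [hKMU f hflc hfcs]
  ------------------------------------------------------------------
  -- (γ) the constant `C = ν(K) / νM(M ∩ K)`
  ------------------------------------------------------------------
  have hKKset : (Set.univ : Set ↥(glInt N F)) = ((KK : PositiveCompacts ↥(glInt N F)) : Set ↥(glInt N F)) := rfl
  have hμKuniv : μK.real Set.univ = 1 := by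
    rw [measureReal_def, hKKset, hμK, haarMeasure_self, ENNReal.toReal_one]
  -- the three compact open subgroups `P ∩ K ≤ P`, `M ∩ K ≤ M`, `U ∩ K ≤ U`
  have hPKo : IsOpen (((glInt N F).comap (standardParabolicGL F c).subtype : Subgroup ↥(standardParabolicGL F c)) : Set ↥(standardParabolicGL F c)) :=
    hKo.preimage continuous_subtype_val
  have hPKc : IsCompact (((glInt N F).comap (standardParabolicGL F c).subtype : Subgroup ↥(standardParabolicGL F c)) : Set ↥(standardParabolicGL F c)) :=
    hPcl.isClosedEmbedding_subtypeVal.isCompact_preimage hKc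
  have hMKo : IsOpen (((glInt N F).comap (standardLeviGL F c).subtype : Subgroup ↥(standardLeviGL F c)) : Set ↥(standardLeviGL F c)) :=
    hKo.preimage continuous_subtype_val
  have hMKc : IsCompact (((glInt N F).comap (standardLeviGL F c).subtype : Subgroup ↥(standardLeviGL F c)) : Set ↥(standardLeviGL F c)) :=
    hMcl.isClosedEmbedding_subtypeVal.isCompact_preimage hKc
  have hUKo : IsOpen (((glInt N F).comap (unipotentRadicalGL F c).subtype : Subgroup ↥(unipotentRadicalGL F c)) : Set ↥(unipotentRadicalGL F c)) :=
    hKo.preimage continuous_subtype_val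
  have hUUset : (((glInt N F).comap (unipotentRadicalGL F c).subtype : Subgroup ↥(unipotentRadicalGL F c)) : Set ↥(unipotentRadicalGL F c)) =
      ((UU : PositiveCompacts ↥(unipotentRadicalGL F c)) : Set ↥(unipotentRadicalGL F c)) := rfl
  have hμUK : μU.real (((glInt N F).comap (unipotentRadicalGL F c).subtype : Subgroup ↥(unipotentRadicalGL F c)) : Set ↥(unipotentRadicalGL F c)) = 1 := by
    rw [measureReal_def, hUUset, hμU, haarMeasure_self, ENNReal.toReal_one]
  -- calibration 1 at `1_K`: `ν.real K = C · μP.real (P ∩ K)`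
  have hcal1 := hHK _ (continuous_indicator_subgroup hKo hKc) (hasCompactSupport_indicator_subgroup hKo hKc)
  have hinner : ∀ k : ↥(glInt N F), (fun p : ↥(standardParabolicGL F c) => (glInt N F : Set (GL (Fin N) F)).indicator (fun _ => (1 : ℂ))
      ((p : GL (Fin N) F) * (k : GL (Fin N) F))) =
      fun p => (((glInt N F).comap (standardParabolicGL F c).subtype : Subgroup ↥(standardParabolicGL F c)) : Set ↥(standardParabolicGL F c)).indicator
        (fun _ => (1 : ℂ)) p := by
    intro k; funext p
    by_cases hp : (p : GL (Fin N) F) ∈ glInt N F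
    · rw [Set.indicator_of_mem (show (p : GL (Fin N) F) * k ∈ (glInt N F : Set _) from (glInt N F).mul_mem hp k.2),
        Set.indicator_of_mem (show p ∈ (((glInt N F).comap (standardParabolicGL F c).subtype : Subgroup _) : Set _) from hp)]
    · rw [Set.indicator_of_notMem (show (p : GL (Fin N) F) * k ∉ (glInt N F : Set _) from fun h =>
          hp (by simpa using (glInt N F).mul_mem h ((glInt N F).inv_mem k.2))),
        Set.indicator_of_notMem (show p ∉ (((glInt N F).comap (standardParabolicGL F c).subtype : Subgroup _) : Set _) from hp)]
  simp_rw [hinner, integral_indicator_subgroup μP hPKo] at hcal1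
  rw [integral_indicator_subgroup ν hKo, integral_const, hμKuniv, one_smul] at hcal1
  -- calibration 2 at `1_{P ∩ K}`: `μP.real (P ∩ K) = νM.real (M ∩ K)`
  have hcal2 := hPint _ (continuous_indicator_subgroup hPKo hPKc) (hasCompactSupport_indicator_subgroup hPKo hPKc)
  have hinner2 : ∀ (m : ↥(standardLeviGL F c)) (u : ↥(unipotentRadicalGL F c)),
      (((glInt N F).comap (standardParabolicGL F c).subtype : Subgroup ↥(standardParabolicGL F c)) : Set ↥(standardParabolicGL F c)).indicator (fun _ => (1 : ℂ))
        (⟨(m : GL (Fin N) F) * (u : GL (Fin N) F), (standardParabolicGL F c).mul_mem (standardLeviGL_le F c m.2) (unipotentRadicalGL_le F c u.2)⟩ :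
          ↥(standardParabolicGL F c)) =
      (((glInt N F).comap (standardLeviGL F c).subtype : Subgroup ↥(standardLeviGL F c)) : Set ↥(standardLeviGL F c)).indicator (fun _ => (1 : ℂ)) m *
        (((glInt N F).comap (unipotentRadicalGL F c).subtype : Subgroup ↥(unipotentRadicalGL F c)) : Set ↥(unipotentRadicalGL F c)).indicator
          (fun _ => (1 : ℂ)) u := by
    intro m u
    have hiff := levi_mul_unipotent_mem_glInt_iff (F := F) (c := c) m.2 u.2
    have hPmem : (⟨(m : GL (Fin N) F) * (u : GL (Fin N) F), (standardParabolicGL F c).mul_mem (standardLeviGL_le F c m.2) (unipotentRadicalGL_le F c u.2)⟩ :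
          ↥(standardParabolicGL F c)) ∈ (((glInt N F).comap (standardParabolicGL F c).subtype : Subgroup ↥(standardParabolicGL F c)) : Set ↥(standardParabolicGL F c)) ↔
        (m : GL (Fin N) F) * (u : GL (Fin N) F) ∈ glInt N F := Iff.rfl
    have hMmem : m ∈ (((glInt N F).comap (standardLeviGL F c).subtype : Subgroup ↥(standardLeviGL F c)) : Set ↥(standardLeviGL F c)) ↔
        (m : GL (Fin N) F) ∈ glInt N F := Iff.rfl
    have hUmem : u ∈ (((glInt N F).comap (unipotentRadicalGL F c).subtype : Subgroup ↥(unipotentRadicalGL F c)) : Set ↥(unipotentRadicalGL F c)) ↔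
        (u : GL (Fin N) F) ∈ glInt N F := Iff.rfl
    by_cases hm : (m : GL (Fin N) F) ∈ glInt N F <;> by_cases hu : (u : GL (Fin N) F) ∈ glInt N F
    · rw [Set.indicator_of_mem (hPmem.2 (hiff.2 ⟨hm, hu⟩)), Set.indicator_of_mem (hMmem.2 hm), Set.indicator_of_mem (hUmem.2 hu), mul_one]
    · rw [Set.indicator_of_notMem (fun h => hu (hiff.1 (hPmem.1 h)).2), Set.indicator_of_notMem (fun h => hu (hUmem.1 h)), mul_zero]
    · rw [Set.indicator_of_notMem (fun h => hm (hiff.1 (hPmem.1 h)).1), Set.indicator_of_notMem (fun h => hm (hMmem.1 h)), zero_mul]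
    · rw [Set.indicator_of_notMem (fun h => hm (hiff.1 (hPmem.1 h)).1), Set.indicator_of_notMem (fun h => hm (hMmem.1 h)), zero_mul]
  simp_rw [hinner2] at hcal2
  simp_rw [integral_const_mul] at hcal2
  rw [integral_indicator_subgroup μU hUKo, hμUK] at hcal2
  rw [integral_indicator_subgroup μP hPKo] at hcal2
  have hcal2' : μP.real (((glInt N F).comap (standardParabolicGL F c).subtype : Subgroup ↥(standardParabolicGL F c)) : Set ↥(standardParabolicGL F c)) =
      νM.real (((glInt N F).comap (standardLeviGL F c).subtype : Subgroup ↥(standardLeviGL F c)) : Set ↥(standardLeviGL F c)) := by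
    have hC' : ((μP.real (((glInt N F).comap (standardParabolicGL F c).subtype : Subgroup ↥(standardParabolicGL F c)) : Set ↥(standardParabolicGL F c)) : ℝ) : ℂ) =
        ((νM.real (((glInt N F).comap (standardLeviGL F c).subtype : Subgroup ↥(standardLeviGL F c)) : Set ↥(standardLeviGL F c)) : ℝ) : ℂ) := by
      rw [hcal2, ← integral_indicator_subgroup νM hMKo]
      refine integral_congr_ae (Filter.Eventually.of_forall fun m => ?_)
      simp only [Complex.ofReal_one, mul_one]
    exact_mod_cast hC'
  clear hcal2
  have hcal2 := hcal2'
  -- hence `C = ν K / νM (M ∩ K)`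
  have hνMpos : (νM.real (((glInt N F).comap (standardLeviGL F c).subtype : Subgroup ↥(standardLeviGL F c)) : Set ↥(standardLeviGL F c))) ≠ 0 := by
    rw [measureReal_def, ENNReal.toReal_ne_zero]
    exact ⟨(hMKo.measure_pos νM ⟨1, Subgroup.one_mem _⟩).ne', hMKc.measure_lt_top.ne⟩
  have hCeq : (C : ℂ) = (((ν (glInt N F : Set (GL (Fin N) F))).toReal /
      (νM {m : ↥(standardLeviGL F c) | (m : GL (Fin N) F) ∈ glInt N F}).toReal : ℝ) : ℂ) := by
    have h1 : ν.real (glInt N F : Set (GL (Fin N) F)) = C * νM.real (((glInt N F).comap (standardLeviGL F c).subtype : Subgroup ↥(standardLeviGL F c)) :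
        Set ↥(standardLeviGL F c)) := by
      have := hcal1
      rw [hcal2] at this
      exact_mod_cast this
    have hpos' : (νM {m : ↥(standardLeviGL F c) | (m : GL (Fin N) F) ∈ glInt N F}).toReal ≠ 0 := hνMpos
    have h1' : (ν (glInt N F : Set (GL (Fin N) F))).toReal = C * (νM {m : ↥(standardLeviGL F c) | (m : GL (Fin N) F) ∈ glInt N F}).toReal := h1
    congr 1
    rw [eq_div_iff hpos']
    exact h1'.symm
  ------------------------------------------------------------------
  -- (α)(β) Fubini, `k ↦ k⁻¹`, and the product integral
  ------------------------------------------------------------------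
  rw [hCeq, integral_const_mul]
  congr 1
  obtain ⟨e, he⟩ := exists_homeomorph_levi_prod_unipotent_coe_eq (R := F) (c := c)
  -- the integrand and its factors
  have hχc : Continuous fun m : ↥(standardLeviGL F c) =>
      ((χ (leviProjection F c ⟨(m : GL (Fin N) F), standardLeviGL_le F c m.2⟩) : ℂˣ) : ℂ) :=
    (isLocallyConstant_unitsCoe_of_isOpen_ker' χ hχ).continuous.comp
      ((continuous_leviProjection F c).comp (continuous_subtype_val.subtype_mk _))
  have hδc : Continuous fun m : ↥(standardLeviGL F c) =>
      ((rootDeltaChar (standardParabolicGL F c) ⟨(m : GL (Fin N) F), standardLeviGL_le F c m.2⟩ : ℂˣ) : ℂ) :=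
    (continuous_rootDeltaChar_unitsCoe' (standardParabolicGL F c)).comp (continuous_subtype_val.subtype_mk _)
  set τM : ↥(standardLeviGL F c) → ℂ := fun m =>
      ((χ (leviProjection F c ⟨(m : GL (Fin N) F), standardLeviGL_le F c m.2⟩) : ℂˣ) : ℂ) *
        ((rootDeltaChar (standardParabolicGL F c) ⟨(m : GL (Fin N) F), standardLeviGL_le F c m.2⟩ : ℂˣ) : ℂ) with hτM
  have hτMc : Continuous τM := hχc.mul hδc
  -- the triple integrand on `K × (M × U)`
  set H3 : ↥(glInt N F) × (↥(standardLeviGL F c) × ↥(unipotentRadicalGL F c)) → ℂ := fun t =>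
      f ((t.1 : GL (Fin N) F)⁻¹ * ((t.2.1 : GL (Fin N) F) * (t.2.2 : GL (Fin N) F)) * (t.1 : GL (Fin N) F)) * τM t.2.1 with hH3
  have hfc : Continuous f := hflc.continuous
  have hH3c : Continuous H3 :=
    (hfc.comp (((continuous_subtype_val.comp continuous_fst).inv.mul
      ((continuous_subtype_val.comp (continuous_fst.comp continuous_snd)).mul (continuous_subtype_val.comp (continuous_snd.comp continuous_snd)))).mul
      (continuous_subtype_val.comp continuous_fst))).mul (hτMc.comp (continuous_fst.comp continuous_snd))
  -- compact support of `H3`: `m u ∈ K · tsupport f · K`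
  set T : Set (GL (Fin N) F) := (fun t : GL (Fin N) F × GL (Fin N) F × GL (Fin N) F => t.1 * t.2.1 * t.2.2) ''
      ((glInt N F : Set (GL (Fin N) F)) ×ˢ tsupport f ×ˢ (glInt N F : Set (GL (Fin N) F))) with hTdef
  have hT : IsCompact T := isCompact_glInt_mul_mul_glInt (F := F) (N := N) hfcs.isCompact
  have hmem3 : ∀ (k : ↥(glInt N F)) (q : ↥(standardLeviGL F c) × ↥(unipotentRadicalGL F c)),
      f ((k : GL (Fin N) F)⁻¹ * ((q.1 : GL (Fin N) F) * (q.2 : GL (Fin N) F)) * (k : GL (Fin N) F)) ≠ 0 →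
        (q.1 : GL (Fin N) F) * (q.2 : GL (Fin N) F) ∈ T := by
    intro k q hne
    refine ⟨((k : GL (Fin N) F), (k : GL (Fin N) F)⁻¹ * ((q.1 : GL (Fin N) F) * (q.2 : GL (Fin N) F)) * (k : GL (Fin N) F), (k : GL (Fin N) F)⁻¹),
      Set.mk_mem_prod k.2 (Set.mk_mem_prod (subset_tsupport _ hne) ((glInt N F).inv_mem k.2)), ?_⟩
    simp only
    group
  set g₂ : ↥(standardLeviGL F c) × ↥(unipotentRadicalGL F c) → ℂ := fun q => T.indicator (fun _ => (1 : ℂ)) ((q.1 : GL (Fin N) F) * (q.2 : GL (Fin N) F))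
    with hg₂
  have hS2 : HasCompactSupport g₂ :=
    hasCompactSupport_of_levi_mul_unipotent_mem (F := F) e he hT fun q hq => by
      by_contra h; exact hq (by simp only [hg₂]; exact Set.indicator_of_notMem h _)
  -- outside `tsupport g₂` (compact) the integrand vanishes, for every `k`
  have hzero : ∀ (k : ↥(glInt N F)) (q : ↥(standardLeviGL F c) × ↥(unipotentRadicalGL F c)), q ∉ tsupport g₂ → H3 (k, q) = 0 := by
    intro k q hq
    have h0 : g₂ q = 0 := image_eq_zero_of_notMem_tsupport hq
    simp only [hH3]
    by_contra hne
    have hne' : f ((k : GL (Fin N) F)⁻¹ * ((q.1 : GL (Fin N) F) * (q.2 : GL (Fin N) F)) * (k : GL (Fin N) F)) ≠ 0 := fun h => hne (by rw [h, zero_mul])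
    have := hmem3 k q hne'
    simp only [hg₂] at h0
    rw [Set.indicator_of_mem this] at h0
    exact one_ne_zero h0
  have hH3s : HasCompactSupport H3 := by
    refine HasCompactSupport.intro' (isCompact_univ.prod hS2.isCompact) (isClosed_univ.prod (isClosed_tsupport _)) fun t ht => ?_
    have ht2 : t.2 ∉ _ := fun h => ht (Set.mk_mem_prod (Set.mem_univ _) h)
    exact hzero t.1 t.2 ht2
  have hI2 : Integrable H3 (μK.prod (νM.prod μU)) := hH3c.integrable_of_hasCompactSupport hH3s
  have hI3 : Integrable (fun t : (↥(standardLeviGL F c) × ↥(unipotentRadicalGL F c)) × ↥(glInt N F) => H3 (t.2, t.1)) ((νM.prod μU).prod μK) :=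
    hI2.swap
  have hIk : ∀ k : ↥(glInt N F), Integrable (fun q : ↥(standardLeviGL F c) × ↥(unipotentRadicalGL F c) => H3 (k, q)) (νM.prod μU) := fun k =>
    (hH3c.comp (Continuous.prodMk_right k)).integrable_of_hasCompactSupport
      (HasCompactSupport.intro' hS2.isCompact (isClosed_tsupport _) fun q hq => hzero k q hq)
  -- Step A: `∫_M ∫_U = ∫_{M×U}` inside `∫_K`
  have hA : ∀ k : ↥(glInt N F), ∫ m : ↥(standardLeviGL F c), ∫ u : ↥(unipotentRadicalGL F c),
      f ((k : GL (Fin N) F)⁻¹ * ((m : GL (Fin N) F) * (u : GL (Fin N) F)) * (k : GL (Fin N) F)) * τM m ∂μU ∂νM =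
      ∫ q : ↥(standardLeviGL F c) × ↥(unipotentRadicalGL F c), H3 (k, q) ∂(νM.prod μU) := by
    intro k
    rw [integral_prod _ (hIk k)]
  have hτM' : ∀ m : ↥(standardLeviGL F c), ((χ (leviProjection F c ⟨(m : GL (Fin N) F), standardLeviGL_le F c m.2⟩) : ℂˣ) : ℂ) *
      ((rootDeltaChar (standardParabolicGL F c) ⟨(m : GL (Fin N) F), standardLeviGL_le F c m.2⟩ : ℂˣ) : ℂ) = τM m := fun m => rfl
  simp_rw [hτM', hA]
  -- Step B: swap `∫_K` and `∫_{M×U}`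
  have hI2' : Integrable (Function.uncurry fun (k : ↥(glInt N F)) (q : ↥(standardLeviGL F c) × ↥(unipotentRadicalGL F c)) => H3 (k, q))
      (μK.prod (νM.prod μU)) := hI2
  rw [integral_integral_swap hI2']
  -- Step C: `∫_{M×U} = ∫_M ∫_U`
  rw [integral_prod _ hI3.integral_prod_left]
  refine integral_congr_ae (Filter.Eventually.of_forall fun m => ?_)
  simp only [hH3]
  -- Step D (pointwise in `m`): pull `τ(m)`, `k ↦ k⁻¹`, `∫_U ∫_K = ∫_{K×U}`
  have hinv : ∀ u : ↥(unipotentRadicalGL F c), ∫ k : ↥(glInt N F), f ((k : GL (Fin N) F)⁻¹ * ((m : GL (Fin N) F) * (u : GL (Fin N) F)) * (k : GL (Fin N) F)) * τM m ∂μK =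
      (∫ k : ↥(glInt N F), f ((k : GL (Fin N) F) * ((m : GL (Fin N) F) * (u : GL (Fin N) F)) * (k : GL (Fin N) F)⁻¹) ∂μK) * τM m := by
    intro u
    rw [integral_mul_const, ← integral_inv_eq_self (fun k : ↥(glInt N F) => f ((k : GL (Fin N) F) * ((m : GL (Fin N) F) * (u : GL (Fin N) F)) * (k : GL (Fin N) F)⁻¹)) μK]
    simp only [Subgroup.coe_inv, inv_inv]
  simp_rw [hinv]
  rw [integral_mul_const]
  -- `∫_U ∫_K g = ∫_{K×U} g`
  have hI4 : Integrable (fun z : ↥(glInt N F) × ↥(unipotentRadicalGL F c) =>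
      f ((z.1 : GL (Fin N) F) * ((m : GL (Fin N) F) * (z.2 : GL (Fin N) F)) * (z.1 : GL (Fin N) F)⁻¹)) (μK.prod μU) := by
    refine (hfc.comp (((continuous_subtype_val.comp continuous_fst).mul (continuous_const.mul (continuous_subtype_val.comp continuous_snd))).mul
      (continuous_subtype_val.comp continuous_fst).inv)).integrable_of_hasCompactSupport ?_
    -- support ⊆ univ × {u | m u ∈ K⁻¹·tsupport f·K ... } : use the closed embedding `U ↪ G` and the compact `m⁻¹ · (K · tsupport f · K)`
    have hT' : IsCompact ((fun g : GL (Fin N) F => (m : GL (Fin N) F)⁻¹ * g) '' T) := hT.image (continuous_const.mul continuous_id)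
    have hUT : IsCompact (((↑) : ↥(unipotentRadicalGL F c) → GL (Fin N) F) ⁻¹' ((fun g : GL (Fin N) F => (m : GL (Fin N) F)⁻¹ * g) '' T)) :=
      hUcl.isClosedEmbedding_subtypeVal.isCompact_preimage hT'
    refine HasCompactSupport.intro' (isCompact_univ.prod hUT) (isClosed_univ.prod hUT.isClosed) fun z hz => ?_
    have hz2 : z.2 ∉ ((↑) : ↥(unipotentRadicalGL F c) → GL (Fin N) F) ⁻¹' ((fun g : GL (Fin N) F => (m : GL (Fin N) F)⁻¹ * g) '' T) :=
      fun h => hz (Set.mk_mem_prod (Set.mem_univ _) h)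
    by_contra hne
    apply hz2
    refine ⟨(m : GL (Fin N) F) * (z.2 : GL (Fin N) F), ⟨((z.1 : GL (Fin N) F)⁻¹, (z.1 : GL (Fin N) F) * ((m : GL (Fin N) F) * (z.2 : GL (Fin N) F)) * (z.1 : GL (Fin N) F)⁻¹, (z.1 : GL (Fin N) F)),
      Set.mk_mem_prod ((glInt N F).inv_mem z.1.2) (Set.mk_mem_prod (subset_tsupport _ hne) z.1.2), by simp only; group⟩, by simp only; group⟩
  rw [← integral_prod_symm _ hI4]
  simp only [hτM]
  ring

end Literature.NumberTheory.Automorphic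

end
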